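import Summits.SmoothPoincare4.SmoothPoincare4.Theses.EntropyRung
import Summits.SmoothPoincare4.SmoothPoincare4.Theorems.EntropyRungSubcylindricalExistenceSphereSideClause
import Summits.SmoothPoincare4.SmoothPoincare4.Theorems.EntropyRungSubcylindricalExistenceRoundClauseEuclidean
import Summits.SmoothPoincare4.SmoothPoincare4.Theorems.EntropyRungSubcylindricalExistenceGradSqFlatChart
import Summits.SmoothPoincare4.SmoothPoincare4.Theorems.EntropyRungSubcylindricalExistenceSetIntegralFlatChart
import HarnessLib

/-!
# The cap-side floor on `M` (stub `helper_capFloor`, H-cap, line `fat-conical-core-avr-logsobolev`,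
crux `EntropyRung.SubcylindricalExistence`, item stmt-SmoothPoincare4-10871)

Let `g` be a Riemannian metric (Levi-Civita) on a closed 4-manifold `M` of the summit binder,
`p : M`, `φ = extChartAt (𝓡 4) p`, `y₀ = φ p`, and suppose `g` is EUCLIDEAN in the chart on the
closed ball `B̄(y₀, r) ⊆ φ.target` (`g(dφ⁻¹X, dφ⁻¹W) = ⟪X, W⟫`). Let `0 < A, a, s_J` with `s_J < r²`
and let `Φ : M → ℝ` be a continuous positive weight equal to the ROUND profile on the cap:
`Φ(φ⁻¹ y) = 2Aa/(a² + ‖y − y₀‖²)` for `‖y − y₀‖² ≤ s_J` (so `Φ² g` restricted to the cap is the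
round sphere of radius `A` in stereographic coordinates, scalar curvature `12/A²`). Then for every
`τ > 0` and every smooth `w` supported in the cap ball (`w x ≠ 0 → x ∈ φ.source ∧
‖φ x − y₀‖² < s_J`) with `∫ (4πτ)⁻² w² Φ⁴ dV_g = 1`:
`log 6 − 2 ≤ ∫ [τ((12/A²) w² + 4 Φ⁻² |∇w|²_g) − w² log w² − 4 w²] (4πτ)⁻² Φ⁴ dV_g`.

Proof (the transport of `SphereSideClause.sphereSideClause'`, without curvature term). The support
of `w` lies in the compact set `φ⁻¹{‖y − y₀‖² ≤ s_J}`, inside the open chart ball. The integrands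
vanish off the closed chart region, where `dV_g` is Lebesgue measure (`stub_setIntegralFlatChart`)
and `|∇w|²_g = ‖∇(w ∘ φ⁻¹)‖²` (`stub_gradSqFlatChart`); the compactly supported smooth chart
extension `V = 𝟙_{target} (w ∘ φ⁻¹)` and its gradient vanish where the round formula for `Φ` is not
available. After the translation `y ↦ y − y₀`, since `2Aa/(a² + ‖z‖²) = A · u_l(z)` with `l = 2/a`,
`u_l(z) = 4l/(l²‖z‖² + 4)`, and `(4πτ)⁻² A⁴ = (4π τ/A²)⁻²`, the functional is LITERALLY the
stereographic RoundBound functional of `stub_roundClauseEuclidean` at scale `τ/A²`, and the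
normalisations agree. References: Lee–Parker 1987, §3 (stereographic coordinates, `dV = u⁴ dy`);
Perelman 2002, §3 (the `𝒲`-functional, `ν(S⁴) = log 6 − 2` in this normalisation). [folklore]
-/

noncomputable section

-- the registered namespace `Summit.SmoothPoincare4.SmoothPoincare4.Theorems` repeats a component
set_option linter.dupNamespace false

open scoped Manifold ContDiff Topology RealInnerProductSpace
open Set Filter MeasureTheory
open Literature.Geometry.Lorentzian Literature.Geometry.Riemannian

namespace Summit.SmoothPoincare4.SmoothPoincare4.Theorems

namespace CapFloor

open SphereSideClause

/-! ### The weight algebra of the substitution `τ ↦ τ/A²`, `l = 2/a` -/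

/-- In stereographic coordinates with `l = 2/a`, the round profile is
`u_l = l·4/(l² m + 4) = 2a/(a² + m)` (`m = ‖z‖²`). [folklore] -/
theorem profile_eq {a : ℝ} (ha : 0 < a) {m : ℝ} (hm : 0 ≤ m) :
    2 / a * (4 / ((2 / a) ^ 2 * m + 4)) = 2 * a / (a ^ 2 + m) := by
  have h1 : a ^ 2 + m ≠ 0 := by positivity
  field_simp
  ring

/-- The weight algebra of the normalisation: for `l = 2/a`,
`(4π τ/A²)^{-2} u_l⁴ = (4πτ)^{-2} (2Aa/(a² + m))⁴`. [folklore] -/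
theorem weight_identity₀ {A a τ m : ℝ} (hA : 0 < A) (ha : 0 < a) (hτ : 0 < τ) (hm : 0 ≤ m) :
    (4 * Real.pi * (τ / A ^ 2)) ^ (-(4 : ℝ) / 2) * (2 / a * (4 / ((2 / a) ^ 2 * m + 4))) ^ 4 =
      (4 * Real.pi * τ) ^ (-(4 : ℝ) / 2) * (2 * A * a / (a ^ 2 + m)) ^ 4 := by
  rw [rpow_neg_four_half (by positivity), rpow_neg_four_half (by positivity), profile_eq ha hm]
  have h1 : a ^ 2 + m ≠ 0 := by positivity
  field_simp

/-- The weight algebra of the substitution, full integrand: the stereographic RoundBound integrand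
at scale `τ/A²` for `l = 2/a` is the `Φ`-weighted integrand with curvature weight `12/A²` at scale
`τ`, `Φ = 2Aa/(a² + m) = A u_l`. [folklore] -/
theorem weight_identity {A a τ m : ℝ} (hA : 0 < A) (ha : 0 < a) (hτ : 0 < τ) (hm : 0 ≤ m)
    (V2 Gn Lg : ℝ) :
    (τ / A ^ 2 * (12 * V2 + 4 * ((2 / a * (4 / ((2 / a) ^ 2 * m + 4)))⁻¹ ^ 2 * Gn)) - Lg - 4 * V2) *
        ((4 * Real.pi * (τ / A ^ 2)) ^ (-(4 : ℝ) / 2) *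
          (2 / a * (4 / ((2 / a) ^ 2 * m + 4))) ^ 4) =
      (τ * (12 / A ^ 2 * V2 + 4 * ((2 * A * a / (a ^ 2 + m))⁻¹ ^ 2 * Gn)) - Lg - 4 * V2) *
        ((4 * Real.pi * τ) ^ (-(4 : ℝ) / 2) * (2 * A * a / (a ^ 2 + m)) ^ 4) := by
  rw [weight_identity₀ hA ha hτ hm, profile_eq ha hm]
  congr 1
  have h1 : a ^ 2 + m ≠ 0 := by positivity
  field_simp

/-! ### The cap-side floor -/

/-- **The cap-side floor on `M` (workhorse form of `helper_capFloor`).** See the module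
docstring. [folklore] -/
theorem capFloor'
    {M : Type} [TopologicalSpace M] [T2Space M] [SecondCountableTopology M]
    [ChartedSpace (EuclideanSpace ℝ (Fin 4)) M] [IsManifold (𝓡 4) ∞ M] [CompactSpace M]
    [T3Space M] [MeasurableSpace M] [BorelSpace M]
    (g : PseudoRiemannianMetric (𝓡 4) ∞ (EuclideanSpace ℝ (Fin 4)) (TangentSpace (𝓡 4) : M → Type _))
    [g.HasLeviCivita] (hg : g.IsRiemannian) {p : M} {r : ℝ} {Φ : M → ℝ} {A a sJ : ℝ}
    (hball : Metric.closedBall (extChartAt (𝓡 4) p p) r ⊆ (extChartAt (𝓡 4) p).target)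
    (hflat : ∀ y ∈ Metric.closedBall (extChartAt (𝓡 4) p p) r, ∀ X W : EuclideanSpace ℝ (Fin 4),
      g.val ((extChartAt (𝓡 4) p).symm y)
        (mfderiv 𝓘(ℝ, EuclideanSpace ℝ (Fin 4)) (𝓡 4) (extChartAt (𝓡 4) p).symm y X)
        (mfderiv 𝓘(ℝ, EuclideanSpace ℝ (Fin 4)) (𝓡 4) (extChartAt (𝓡 4) p).symm y W) = ⟪X, W⟫)
    (hr : 0 < r) (hA : 0 < A) (ha : 0 < a) (hsJr : sJ < r ^ 2)
    (hΦc : Continuous Φ) (hΦpos : ∀ x, 0 < Φ x)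
    (hΦchart : ∀ y ∈ Metric.ball (extChartAt (𝓡 4) p p) r,
      ‖y - extChartAt (𝓡 4) p p‖ ^ 2 ≤ sJ →
        Φ ((extChartAt (𝓡 4) p).symm y) = 2 * A * a / (a ^ 2 + ‖y - extChartAt (𝓡 4) p p‖ ^ 2))
    {τ : ℝ} (hτ : 0 < τ) {w : M → ℝ} (hw : ContMDiff (𝓡 4) 𝓘(ℝ, ℝ) ∞ w)
    (hwsupp : ∀ x, w x ≠ 0 →
      x ∈ (extChartAt (𝓡 4) p).source ∧ ‖extChartAt (𝓡 4) p x - extChartAt (𝓡 4) p p‖ ^ 2 < sJ)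
    (hnorm : ∫ x, (4 * Real.pi * τ) ^ (-(4 : ℝ) / 2) * (w x) ^ 2 * (Φ x) ^ 4
      ∂(riemannianMeasure (g.toContMDiffRiemannianMetric hg)) = 1) :
    Real.log 6 - 2 ≤
      ∫ x, (τ * (12 / A ^ 2 * (w x) ^ 2 + 4 * ((Φ x)⁻¹ ^ 2 * g.gradSq w x))
          - (w x) ^ 2 * Real.log ((w x) ^ 2) - 4 * (w x) ^ 2)
          * ((4 * Real.pi * τ) ^ (-(4 : ℝ) / 2) * (Φ x) ^ 4)
        ∂(riemannianMeasure (g.toContMDiffRiemannianMetric hg)) := by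
  have hS0 := stub_gradSqFlatChart M g p
  have hS0b := stub_setIntegralFlatChart M g hg p r hr hball hflat
  /- positivity and continuity -/
  have hΦne : ∀ x, Φ x ≠ 0 := fun x ↦ (hΦpos x).ne'
  have hwc : Continuous w := hw.continuous
  have hQc : Continuous (g.gradSq w) := (contMDiff_gradSq g hw).continuous
  /- the cap `{‖y − y₀‖² ≤ s_J}` in the chart: inside the open ball, compact preimage -/
  have hKball : ∀ y : EuclideanSpace ℝ (Fin 4), ‖y - extChartAt (𝓡 4) p p‖ ^ 2 ≤ sJ →
      y ∈ Metric.ball (extChartAt (𝓡 4) p p) r := by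
    intro y hy
    rw [Metric.mem_ball, dist_eq_norm]
    exact (pow_lt_pow_iff_left₀ (norm_nonneg _) hr.le two_ne_zero).1 (hy.trans_lt hsJr)
  have hKt : ∀ y : EuclideanSpace ℝ (Fin 4), ‖y - extChartAt (𝓡 4) p p‖ ^ 2 ≤ sJ →
      y ∈ (extChartAt (𝓡 4) p).target :=
    fun y hy ↦ hball (Metric.ball_subset_closedBall (hKball y hy))
  have hKcpt : IsCompact {y : EuclideanSpace ℝ (Fin 4) | ‖y - extChartAt (𝓡 4) p p‖ ^ 2 ≤ sJ} :=
    (isCompact_closedBall (extChartAt (𝓡 4) p p) r).of_isClosed_subset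
      (isClosed_le (by fun_prop) continuous_const)
      fun y hy ↦ Metric.ball_subset_closedBall (hKball y hy)
  /- the support of `w` -/
  have htsupp : tsupport w ⊆ (extChartAt (𝓡 4) p).symm ''
      {y : EuclideanSpace ℝ (Fin 4) | ‖y - extChartAt (𝓡 4) p p‖ ^ 2 ≤ sJ} := by
    refine closure_minimal ?_ ((hKcpt.image_of_continuousOn
      ((continuousOn_extChartAt_symm p).mono fun y hy ↦ hKt y hy)).isClosed)
    intro x hx
    obtain ⟨hxs, hxlt⟩ := hwsupp x hx
    exact ⟨extChartAt (𝓡 4) p x, hxlt.le, (extChartAt (𝓡 4) p).left_inv hxs⟩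
  have hcap : ∀ x ∈ tsupport w, x ∈ (extChartAt (𝓡 4) p).source ∧
      ‖extChartAt (𝓡 4) p x - extChartAt (𝓡 4) p p‖ ^ 2 ≤ sJ := by
    intro x hx
    obtain ⟨y, hy, rfl⟩ := htsupp hx
    refine ⟨(extChartAt (𝓡 4) p).map_target (hKt y hy), ?_⟩
    rw [(extChartAt (𝓡 4) p).right_inv (hKt y hy)]
    exact hy
  have hsupp : tsupport w ⊆ {x | x ∈ (extChartAt (𝓡 4) p).source ∧
      extChartAt (𝓡 4) p x ∈ Metric.ball (extChartAt (𝓡 4) p p) r} :=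
    fun x hx ↦ ⟨(hcap x hx).1, hKball _ (hcap x hx).2⟩
  have hsub : tsupport w ⊆ (extChartAt (𝓡 4) p).source := fun x hx ↦ (hsupp hx).1
  have hv0 : ∀ x, x ∉ {x | x ∈ (extChartAt (𝓡 4) p).source ∧
      extChartAt (𝓡 4) p x ∈ Metric.closedBall (extChartAt (𝓡 4) p p) r} →
      w x = 0 ∧ g.gradSq w x = 0 := by
    intro x hx
    have hx' : x ∉ tsupport w := fun h ↦
      hx ⟨(hsupp h).1, Metric.ball_subset_closedBall (hsupp h).2⟩
    refine ⟨image_eq_zero_of_notMem_tsupport hx', ?_⟩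
    have hev : w =ᶠ[𝓝 x] fun _ ↦ (0 : ℝ) := notMem_tsupport_iff_eventuallyEq.1 hx'
    rw [show g.gradSq w x = g.gradSq (fun _ : M ↦ (0 : ℝ)) x by
      simp only [PseudoRiemannianMetric.gradSq, mvfderiv_congr_of_eventuallyEq hev]]
    exact g.gradSq_const 0 x
  /- the chart extension of `w` -/
  have hVcd := chartExt_contDiff p hw hsub
  have hVcs := chartExt_hasCompactSupport p hsub
  have hVapply : ∀ y ∈ Metric.closedBall (extChartAt (𝓡 4) p p) r,
      (extChartAt (𝓡 4) p).target.indicator (w ∘ (extChartAt (𝓡 4) p).symm) y =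
        w ((extChartAt (𝓡 4) p).symm y) := fun y hy ↦ indicator_of_mem (hball hy) _
  have hVgrad : ∀ y ∈ Metric.closedBall (extChartAt (𝓡 4) p p) r,
      g.gradSq w ((extChartAt (𝓡 4) p).symm y) =
        ‖gradient ((extChartAt (𝓡 4) p).target.indicator (w ∘ (extChartAt (𝓡 4) p).symm))
          y‖ ^ 2 := by
    intro y hy
    rw [hS0 y (hball hy) (hflat y hy) w (hw.mdifferentiableAt (by simp)),
      (chartExt_eventuallyEq p w (hball hy)).gradient_eq]
  have hVzero : ∀ y : EuclideanSpace ℝ (Fin 4), ¬ ‖y - extChartAt (𝓡 4) p p‖ ^ 2 ≤ sJ →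
      (extChartAt (𝓡 4) p).target.indicator (w ∘ (extChartAt (𝓡 4) p).symm) y = 0 ∧
      gradient ((extChartAt (𝓡 4) p).target.indicator (w ∘ (extChartAt (𝓡 4) p).symm)) y = 0 := by
    intro y hy
    refine chartExt_eq_zero p hsub ?_
    rintro ⟨x, hx, rfl⟩
    exact hy (hcap x hx).2
  /- `Φ` in the chart -/
  have hΦchart' : ∀ y : EuclideanSpace ℝ (Fin 4), ‖y - extChartAt (𝓡 4) p p‖ ^ 2 ≤ sJ →
      Φ ((extChartAt (𝓡 4) p).symm y) = 2 * A * a / (a ^ 2 + ‖y - extChartAt (𝓡 4) p p‖ ^ 2) :=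
    fun y hy ↦ hΦchart y (hKball y hy) hy
  clear hS0 hflat hKcpt htsupp hcap hΦchart
  /- abstract the chart and the extension -/
  generalize hV : (extChartAt (𝓡 4) p).target.indicator (w ∘ (extChartAt (𝓡 4) p).symm) = V at *
  generalize hφ : extChartAt (𝓡 4) p = φ at *
  have hτ' : 0 < τ / A ^ 2 := by positivity
  have hl : 0 < 2 / a := by positivity
  /- Step 1: the normalisation transported to `ℝ⁴` -/
  have hnormE : ∫ z : EuclideanSpace ℝ (Fin 4), (4 * Real.pi * (τ / A ^ 2)) ^ (-(4 : ℝ) / 2) *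
      (V (z + φ p)) ^ 2 * (2 / a * (4 / ((2 / a) ^ 2 * ‖z‖ ^ 2 + 4))) ^ 4 = 1 := by
    have hT := transfer (F := fun x ↦ (4 * Real.pi * τ) ^ (-(4 : ℝ) / 2) * (w x) ^ 2 * (Φ x) ^ 4)
      (FE := fun y ↦ (4 * Real.pi * τ) ^ (-(4 : ℝ) / 2) * (V y) ^ 2 *
        (2 * A * a / (a ^ 2 + ‖y - φ p‖ ^ 2)) ^ 4) hS0b
      (by fun_prop) (fun x hx ↦ by simp [(hv0 x hx).1])
      (fun y hy ↦ by
        by_cases hyK : ‖y - φ p‖ ^ 2 ≤ sJ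
        · simp only [hVapply y hy, hΦchart' y hyK]
        · have h1 := (hVzero y hyK).1
          have h2 : w (φ.symm y) = 0 := by rw [← hVapply y hy, h1]
          simp [h1, h2])
      (fun y hy ↦ by
        simp [(hVzero y fun h ↦ hy (Metric.ball_subset_closedBall (hKball y h))).1])
    rw [hnorm] at hT
    rw [hT]
    refine integral_congr_ae (Eventually.of_forall fun z ↦ ?_)
    simp only [add_sub_cancel_right]
    have hwI := weight_identity₀ (m := ‖z‖ ^ 2) hA ha hτ (sq_nonneg _)
    calc (4 * Real.pi * (τ / A ^ 2)) ^ (-(4 : ℝ) / 2) * (V (z + φ p)) ^ 2 *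
          (2 / a * (4 / ((2 / a) ^ 2 * ‖z‖ ^ 2 + 4))) ^ 4
        = (V (z + φ p)) ^ 2 * ((4 * Real.pi * (τ / A ^ 2)) ^ (-(4 : ℝ) / 2) *
          (2 / a * (4 / ((2 / a) ^ 2 * ‖z‖ ^ 2 + 4))) ^ 4) := by ring
      _ = (V (z + φ p)) ^ 2 * ((4 * Real.pi * τ) ^ (-(4 : ℝ) / 2) *
          (2 * A * a / (a ^ 2 + ‖z‖ ^ 2)) ^ 4) := by rw [hwI]
      _ = _ := by ring
  /- Step 2: RoundBound on `ℝ⁴` at scale `τ/A²` for the translated extension -/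
  have hVtc : ContDiff ℝ ∞ fun z : EuclideanSpace ℝ (Fin 4) ↦ V (z + φ p) :=
    hVcd.comp (contDiff_id.add contDiff_const)
  have hVts : HasCompactSupport fun z : EuclideanSpace ℝ (Fin 4) ↦ V (z + φ p) :=
    hVcs.comp_homeomorph (Homeomorph.addRight (φ p))
  have hS1 := stub_roundClauseEuclidean (2 / a) hl (τ / A ^ 2) hτ' (fun z ↦ V (z + φ p)) hVtc hVts
    hnormE
  /- Step 3: the functional on `M` equals the stereographic functional -/
  have hΦ'c : Continuous fun x ↦ (τ * (12 / A ^ 2 * w x ^ 2 + 4 * ((Φ x)⁻¹ ^ 2 * g.gradSq w x))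
      - w x ^ 2 * Real.log (w x ^ 2) - 4 * w x ^ 2) *
      ((4 * Real.pi * τ) ^ (-(4 : ℝ) / 2) * Φ x ^ 4) :=
    continuous_density continuous_const hwc hQc hΦc hΦne τ _
  have hT2 := transfer
    (F := fun x ↦ (τ * (12 / A ^ 2 * w x ^ 2 + 4 * ((Φ x)⁻¹ ^ 2 * g.gradSq w x))
      - w x ^ 2 * Real.log (w x ^ 2) - 4 * w x ^ 2) *
      ((4 * Real.pi * τ) ^ (-(4 : ℝ) / 2) * Φ x ^ 4))
    (FE := fun y ↦ (τ * (12 / A ^ 2 * V y ^ 2 +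
        4 * ((2 * A * a / (a ^ 2 + ‖y - φ p‖ ^ 2))⁻¹ ^ 2 * ‖gradient V y‖ ^ 2))
      - V y ^ 2 * Real.log (V y ^ 2) - 4 * V y ^ 2) *
        ((4 * Real.pi * τ) ^ (-(4 : ℝ) / 2) * (2 * A * a / (a ^ 2 + ‖y - φ p‖ ^ 2)) ^ 4))
    hS0b hΦ'c
    (fun x hx ↦ by simp [(hv0 x hx).1, (hv0 x hx).2])
    (fun y hy ↦ by
      by_cases hyK : ‖y - φ p‖ ^ 2 ≤ sJ
      · simp only [hVapply y hy, hΦchart' y hyK, hVgrad y hy]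
      · obtain ⟨h1, h2⟩ := hVzero y hyK
        have h3 : w (φ.symm y) = 0 := by rw [← hVapply y hy, h1]
        have h4 : g.gradSq w (φ.symm y) = 0 := by rw [hVgrad y hy, h2, norm_zero, zero_pow two_ne_zero]
        simp [h1, h2, h3, h4])
    (fun y hy ↦ by
      obtain ⟨h1, h2⟩ := hVzero y fun h ↦ hy (Metric.ball_subset_closedBall (hKball y h))
      simp [h1, h2])
  rw [hT2]
  refine hS1.trans_eq (integral_congr_ae (Eventually.of_forall fun z ↦ ?_))
  simp only [gradient_comp_add_right V (φ p) z, add_sub_cancel_right]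
  exact weight_identity (m := ‖z‖ ^ 2) hA ha hτ (sq_nonneg _) _ _ _

end CapFloor

open CapFloor in
/-- **Stub H-cap of line `fat-conical-core-avr-logsobolev` (the cap-side floor on `M`).** For `g`
Euclidean in the chart at `p` on `closedBall _ r` and a continuous positive weight `Φ` equal to the
round profile `2Aa/(a² + ‖y − φ p‖²)` (the sphere of radius `A`, `R = 12/A²`, in stereographic
coordinates) on the chart cap `‖y − φ p‖² ≤ s_J < r²`, every smooth `w` supported in that cap with
`∫ (4πτ)⁻² w² Φ⁴ dV_g = 1` satisfies RoundBound:
`log 6 − 2 ≤ ∫ [τ((12/A²) w² + 4Φ⁻²|∇w|²_g) − w² log w² − 4w²](4πτ)⁻² Φ⁴ dV_g`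
(transport through the flat chart, translation, and the dilation `τ ↦ τ/A²` of
`stub_roundClauseEuclidean`). Lee–Parker 1987 §3; Perelman 2002 §3. [folklore] -/
theorem helper_capFloor :
    ∀ (M : Type) [TopologicalSpace M] [T2Space M] [SecondCountableTopology M]
      [ChartedSpace (EuclideanSpace ℝ (Fin 4)) M] [IsManifold (𝓡 4) ∞ M] [CompactSpace M]
      [T3Space M] [MeasurableSpace M] [BorelSpace M]
      (g : PseudoRiemannianMetric (𝓡 4) ∞ (EuclideanSpace ℝ (Fin 4)) (TangentSpace (𝓡 4) : M → Type _))
      [g.HasLeviCivita] (hg : g.IsRiemannian) (p : M) (r : ℝ) (Φ : M → ℝ) (A a sJ : ℝ),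
      (Metric.closedBall (extChartAt (𝓡 4) p p) r ⊆ (extChartAt (𝓡 4) p).target ∧
        ∀ y ∈ Metric.closedBall (extChartAt (𝓡 4) p p) r, ∀ X W : EuclideanSpace ℝ (Fin 4),
          g.val ((extChartAt (𝓡 4) p).symm y)
            (mfderiv 𝓘(ℝ, EuclideanSpace ℝ (Fin 4)) (𝓡 4) (extChartAt (𝓡 4) p).symm y X)
            (mfderiv 𝓘(ℝ, EuclideanSpace ℝ (Fin 4)) (𝓡 4) (extChartAt (𝓡 4) p).symm y W) = ⟪X, W⟫) →
      0 < r → 0 < A → 0 < a → 0 < sJ → sJ < r ^ 2 → Continuous Φ → (∀ x, 0 < Φ x) →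
      (∀ y ∈ Metric.ball (extChartAt (𝓡 4) p p) r,
        ‖y - extChartAt (𝓡 4) p p‖ ^ 2 ≤ sJ →
          Φ ((extChartAt (𝓡 4) p).symm y) = 2 * A * a / (a ^ 2 + ‖y - extChartAt (𝓡 4) p p‖ ^ 2)) →
      ∀ τ : ℝ, 0 < τ → ∀ w : M → ℝ, ContMDiff (𝓡 4) 𝓘(ℝ, ℝ) ∞ w →
        (∀ x, w x ≠ 0 →
          x ∈ (extChartAt (𝓡 4) p).source ∧ ‖extChartAt (𝓡 4) p x - extChartAt (𝓡 4) p p‖ ^ 2 < sJ) →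
        ∫ x, (4 * Real.pi * τ) ^ (-(4 : ℝ) / 2) * (w x) ^ 2 * (Φ x) ^ 4
            ∂(riemannianMeasure (g.toContMDiffRiemannianMetric hg)) = 1 →
          Real.log 6 - 2 ≤
            ∫ x, (τ * (12 / A ^ 2 * (w x) ^ 2 + 4 * ((Φ x)⁻¹ ^ 2 * g.gradSq w x))
                - (w x) ^ 2 * Real.log ((w x) ^ 2) - 4 * (w x) ^ 2)
                * ((4 * Real.pi * τ) ^ (-(4 : ℝ) / 2) * (Φ x) ^ 4)
              ∂(riemannianMeasure (g.toContMDiffRiemannianMetric hg)) := by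
  intro M _ _ _ _ _ _ _ _ _ g _ hg p r Φ A a sJ hgauge hr hA ha _ hsJr hΦc hΦpos hΦchart τ hτ w hw
    hwsupp hnorm
  exact capFloor' g hg hgauge.1 hgauge.2 hr hA ha hsJr hΦc hΦpos hΦchart hτ hw hwsupp hnorm

end Summit.SmoothPoincare4.SmoothPoincare4.Theorems

end
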